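import Literature.MathematicalPhysics.QuantumLattice.QuantumRotorFourierParseval
import Mathlib.MeasureTheory.Integral.DivergenceTheorem
import Mathlib.Topology.Algebra.Module.FiniteDimension
import HarnessLib

/-!
# Quantum rotators: trigonometric polynomials are dense in the energy form (`M → ∞`)

Sibling file of `QuantumRotorFourierBridge.lean` / `QuantumRotorFourierParseval.lean` (item
`provefact-Literature.MathematicalPhysics.QuantumLa-0bccfc6de5`, the named fact
`QuantumRotor.KleinPerez1992_rotorGroundStateLRO`). No statement is touched. The variational
ground-state energy `QuantumRotor.groundStateEnergy` is an infimum over all `C¹` trial states;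
the Galerkin matrices see only trigonometric polynomials. This file closes the gap:

* **integration by parts on the cell** (`integral_fderiv_single_eq_zero`): for a `C¹` function
  `F` on `ℝ^Λ`, `2π`-periodic in every angle, `∫_{[-π,π)^Λ} ∂_x F = 0` — from Mathlib's divergence
  theorem on the closed cube (`integral_divergence_of_hasFDerivAt_off_countable_of_equiv`), the
  two face integrals cancelling by periodicity; whence the Fourier coefficients of a derivative,
  `A[∂_x ψ](n) = i n_x A[ψ](n)` (`fourierCoeffCell_fderiv`), and `∂_x S_M ψ = S_M ∂_x ψ`
  (`fderiv_fourierPartialSum`);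
* mean-square convergence of `S_M ψ → ψ` and `∂_x S_M ψ → ∂_x ψ` (`QuantumRotorFourierParseval`),
  an elementary weighted continuity lemma, and the normalisation `‖S_M ψ‖₂ → 1`;
* the energy form as a real number (`realEnergy`, `energy_eq_ofReal_realEnergy`) and its scaling;
* **density** (`exists_trialOf_energy_le`): for every trial state `Ψ` and `δ > 0` there are `M` and a
  unit coefficient vector `c` with `energy (trialOf M c) ≤ energy Ψ + δ` (whence, in
  `QuantumRotorGroundStateLROProofs`, the Galerkin ground-state energies decrease to the
  variational ground-state energy).

## References

* A. Klein, J. F. Perez, Commun. Math. Phys. 147 (1992) 241–252, §§2–3 [KleinPerez1992].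
-/

noncomputable section

open MeasureTheory Matrix Complex Finset Set Filter Topology
open scoped ENNReal NNReal ComplexConjugate

namespace Literature.MathematicalPhysics.QuantumLattice

namespace QuantumRotor

variable {Λ : Type} [Fintype Λ] [DecidableEq Λ]

/-! ### Integration by parts on the cell -/

omit [DecidableEq Λ] in
/-- The closed cube `[-π, π]^Λ` and the cell differ by a null set. [folklore] -/
theorem Icc_ae_eq_angleCell :
    (Set.Icc (fun _ : Λ => -Real.pi) (fun _ : Λ => Real.pi)) =ᵐ[volume] angleCell Λ := by
  rw [angleCell_eq_pi, volume_pi, ← Set.pi_univ_Icc]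
  exact Measure.pi_Ico_ae_eq_pi_Icc.symm

/-- **Integration by parts on the cell**: for a `C¹` function `F : ℝ^Λ → ℂ`, `2π`-periodic in
every angle, `∫_{[-π,π)^Λ} ∂_x F = 0`. (Divergence theorem on the cube `[-π, π]^Λ` for the field
`F eₓ`; the front and back faces in direction `x` carry the same values of `F`.) [folklore] -/
theorem integral_fderiv_single_eq_zero [Nonempty Λ] (F : (Λ → ℝ) → ℂ) (hF : ContDiff ℝ 1 F)
    (hFp : ∀ (φ : Λ → ℝ) (x : Λ), F (φ + Pi.single x (2 * Real.pi)) = F φ) (x : Λ) :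
    ∫ φ in angleCell Λ, fderiv ℝ F φ (Pi.single x 1) = 0 := by
  -- `Λ ≃ Fin (n+1)`
  obtain ⟨n, hn⟩ : ∃ n, Fintype.card Λ = n + 1 := ⟨Fintype.card Λ - 1, by have := Fintype.card_pos (α := Λ); omega⟩
  set ε : Fin (n + 1) ≃ Λ := (Fintype.equivFinOfCardEq hn).symm with hε
  set eL : (Λ → ℝ) ≃L[ℝ] (Fin (n + 1) → ℝ) := (LinearEquiv.funCongrLeft ℝ ℝ ε).toContinuousLinearEquiv with heL
  have heL_apply : ∀ (φ : Λ → ℝ) (i : Fin (n + 1)), eL φ i = φ (ε i) := fun φ i => rfl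
  have heL_symm_apply : ∀ (v : Fin (n + 1) → ℝ) (y : Λ), eL.symm v y = v (ε.symm y) := fun v y => rfl
  have he_ord : ∀ φ ψ : Λ → ℝ, eL φ ≤ eL ψ ↔ φ ≤ ψ := by
    intro φ ψ
    simp only [Pi.le_def, heL_apply]
    exact ⟨fun h y => by simpa using h (ε.symm y), fun h i => h (ε i)⟩
  have he_vol : MeasurePreserving eL volume volume := by
    have hfun : (eL : (Λ → ℝ) → (Fin (n + 1) → ℝ)) =
        ⇑(MeasurableEquiv.piCongrLeft (fun _ : Fin (n + 1) => ℝ) ε.symm) := by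
      funext φ i
      rw [heL_apply, MeasurableEquiv.coe_piCongrLeft, Equiv.piCongrLeft_apply, eq_rec_constant,
        Equiv.symm_symm]
    rw [hfun]
    exact volume_measurePreserving_piCongrLeft (fun _ : Fin (n + 1) => ℝ) ε.symm
  -- the vector field `F e_{i₀}`
  set i₀ : Fin (n + 1) := ε.symm x with hi₀
  set f : Fin (n + 1) → (Λ → ℝ) → ℂ := Function.update 0 i₀ F with hf
  set f' : Fin (n + 1) → (Λ → ℝ) → (Λ → ℝ) →L[ℝ] ℂ := Function.update 0 i₀ (fderiv ℝ F) with hf'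
  set a : Λ → ℝ := fun _ => -Real.pi with ha
  set b : Λ → ℝ := fun _ => Real.pi with hb
  have hle : a ≤ b := fun _ => by simp only [ha, hb]; linarith [Real.pi_pos]
  have hFd : Differentiable ℝ F := hF.differentiable one_ne_zero
  have Hc : ∀ i, ContinuousOn (f i) (Set.Icc a b) := by
    intro i
    by_cases hi : i = i₀
    · subst hi; simp only [hf, Function.update_self]; exact hF.continuous.continuousOn
    · simp only [hf, Function.update_of_ne hi, Pi.zero_apply]; exact continuousOn_const
  have Hd : ∀ φ ∈ interior (Set.Icc a b) \ (∅ : Set (Λ → ℝ)), ∀ i, HasFDerivAt (f i) (f' i φ) φ := by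
    intro φ _ i
    by_cases hi : i = i₀
    · subst hi; simp only [hf, hf', Function.update_self]; exact (hFd φ).hasFDerivAt
    · simp only [hf, hf', Function.update_of_ne hi, Pi.zero_apply]; exact hasFDerivAt_const _ _
  have hsymm_single : eL.symm (Pi.single i₀ 1) = Pi.single x 1 := by
    funext y
    rw [heL_symm_apply, Pi.single_apply, Pi.single_apply, hi₀]
    simp only [Equiv.apply_eq_iff_eq]
  set DF : (Λ → ℝ) → ℂ := fun φ => fderiv ℝ F φ (Pi.single x 1) with hDF_def
  have hDF : ∀ φ, DF φ = ∑ i, f' i φ (eL.symm (Pi.single i 1)) := by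
    intro φ
    rw [Finset.sum_eq_single i₀]
    · simp only [hDF_def, hf', Function.update_self, hsymm_single]
    · intro i _ hi
      simp only [hf', Function.update_of_ne hi, Pi.zero_apply, _root_.zero_apply]
    · intro h; exact absurd (Finset.mem_univ _) h
  have hDFc : Continuous DF := (hF.continuous_fderiv one_ne_zero).clm_apply continuous_const
  have Hi : IntegrableOn DF (Set.Icc a b) := hDFc.continuousOn.integrableOn_compact isCompact_Icc
  have key := integral_divergence_of_hasFDerivAt_off_countable_of_equiv eL he_ord he_vol f f' ∅
    Set.countable_empty a b hle Hc Hd DF hDF Hi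
  -- the face integrals cancel by periodicity
  have hfaces : ∀ i : Fin (n + 1),
      (∫ y in Set.Icc (eL a ∘ i.succAbove) (eL b ∘ i.succAbove), f i (eL.symm (i.insertNth (eL b i) y))) =
        ∫ y in Set.Icc (eL a ∘ i.succAbove) (eL b ∘ i.succAbove), f i (eL.symm (i.insertNth (eL a i) y)) := by
    intro i
    by_cases hi : i = i₀
    · subst hi
      refine setIntegral_congr_fun measurableSet_Icc fun y _ => ?_
      simp only [hf, Function.update_self]
      have hshift : eL.symm ((ε.symm x).insertNth (eL b (ε.symm x)) y) =
          eL.symm ((ε.symm x).insertNth (eL a (ε.symm x)) y) + Pi.single x (2 * Real.pi) := by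
        funext y'
        rw [Pi.add_apply, heL_symm_apply, heL_symm_apply, Pi.single_apply]
        by_cases hy' : ε.symm y' = ε.symm x
        · have hyx : y' = x := ε.symm.injective hy'
          rw [hy', Fin.insertNth_apply_same, Fin.insertNth_apply_same, if_pos hyx, heL_apply, heL_apply]
          simp only [ha, hb]
          ring
        · obtain ⟨k, hk⟩ := Fin.exists_succAbove_eq hy'
          have hyx : y' ≠ x := fun h => hy' (by rw [h])
          rw [← hk, Fin.insertNth_apply_succAbove, Fin.insertNth_apply_succAbove, if_neg hyx, add_zero]
      rw [hshift, hFp]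
    · simp only [hf, Function.update_of_ne hi, Pi.zero_apply]
  rw [Finset.sum_eq_zero (fun i _ => by rw [hfaces i, sub_self])] at key
  rwa [setIntegral_congr_set Icc_ae_eq_angleCell] at key

/-- The derivative of a periodic function is periodic. [folklore] -/
theorem fderiv_periodic {ψ : (Λ → ℝ) → ℂ} (hψ : ∀ (φ : Λ → ℝ) (x : Λ), ψ (φ + Pi.single x (2 * Real.pi)) = ψ φ)
    (φ : Λ → ℝ) (x : Λ) : fderiv ℝ ψ (φ + Pi.single x (2 * Real.pi)) = fderiv ℝ ψ φ := by
  have h : (fun φ' => ψ (φ' + Pi.single x (2 * Real.pi))) = ψ := funext fun φ' => hψ φ' x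
  rw [← fderiv_comp_add_right, h]

/-- **The Fourier coefficients of an angular derivative**: for a trial state `Ψ`,
`A[∂_x ψ](n) = i n_x A[ψ](n)` (integration by parts on the cell; `Λ` nonempty).
[cite: KleinPerez1992, §3] -/
theorem fourierCoeffCell_fderiv [Nonempty Λ] (Ψ : TrialState Λ) (n : Λ → ℤ) (x : Λ) :
    fourierCoeffCell (fun φ => fderiv ℝ Ψ.ψ φ (Pi.single x 1)) n = I * (n x : ℂ) * fourierCoeffCell Ψ.ψ n := by
  -- `F = ψ · e_{-n}`
  set F : (Λ → ℝ) → ℂ := fun φ => Ψ.ψ φ * fourierFn (-n) φ with hF_def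
  have hFc : ContDiff ℝ 1 F := Ψ.contDiff.mul (contDiff_fourierFn _)
  have hFp : ∀ (φ : Λ → ℝ) (y : Λ), F (φ + Pi.single y (2 * Real.pi)) = F φ := by
    intro φ y; simp only [hF_def, Ψ.periodic, fourierFn_periodic]
  have hψd : Differentiable ℝ Ψ.ψ := Ψ.contDiff.differentiable one_ne_zero
  have hderiv : ∀ φ : Λ → ℝ, fderiv ℝ F φ (Pi.single x 1) =
      fderiv ℝ Ψ.ψ φ (Pi.single x 1) * conj (fourierFn n φ) +
        (I * ((-n) x : ℂ)) * (Ψ.ψ φ * conj (fourierFn n φ)) := by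
    intro φ
    rw [hF_def, fderiv_fun_mul (hψd φ) ((contDiff_fourierFn (-n) (k := 1)).differentiable one_ne_zero φ),
      _root_.add_apply, FunLike.coe_smul, Pi.smul_apply,
      FunLike.coe_smul, Pi.smul_apply, fderiv_fourierFn_single, conj_fourierFn, smul_eq_mul,
      smul_eq_mul, Pi.neg_apply]
    ring
  have h0 := integral_fderiv_single_eq_zero F hFc hFp x
  simp_rw [hderiv] at h0
  have hi1 : IntegrableOn (fun φ => fderiv ℝ Ψ.ψ φ (Pi.single x 1) * conj (fourierFn n φ)) (angleCell Λ) :=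
    integrableOn_angleCell_of_continuous (((Ψ.contDiff.continuous_fderiv one_ne_zero).clm_apply
      continuous_const).mul (continuous_fourierFn _).star)
  have hi2 : IntegrableOn (fun φ => (I * ((-n) x : ℂ)) * (Ψ.ψ φ * conj (fourierFn n φ))) (angleCell Λ) :=
    integrableOn_angleCell_of_continuous (continuous_const.mul (Ψ.contDiff.continuous.mul
      (continuous_fourierFn _).star))
  rw [integral_add hi1 hi2, integral_const_mul] at h0
  rw [fourierCoeffCell, fourierCoeffCell, eq_sub_of_add_eq h0, zero_sub, Pi.neg_apply]
  push_cast
  ring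

/-- The box partial sum `S_M ψ = Σ_{|n_x| ≤ M} (2π)^{-|Λ|} A(n) e_n` as a function. [cite: KleinPerez1992, §3] -/
def fourierPartialSum (M : ℕ) (G : (Λ → ℝ) → ℂ) : (Λ → ℝ) → ℂ := trigPoly M (partialSumCoeff M G)

/-- **`∂_x S_M ψ = S_M ∂_x ψ`**: the angular derivative of the box partial sum is the box partial
sum of the angular derivative (coefficientwise IBP). [cite: KleinPerez1992, §3] -/
theorem fderiv_fourierPartialSum [Nonempty Λ] (M : ℕ) (Ψ : TrialState Λ) (φ : Λ → ℝ) (x : Λ) :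
    fderiv ℝ (fourierPartialSum M Ψ.ψ) φ (Pi.single x 1) =
      fourierPartialSum M (fun φ => fderiv ℝ Ψ.ψ φ (Pi.single x 1)) φ := by
  rw [fourierPartialSum, fourierPartialSum, fderiv_trigPoly_single]
  congr 1
  funext σ
  rw [partialSumCoeff, partialSumCoeff, fourierCoeffCell_fderiv, momVec_apply]
  push_cast
  ring

/-! ### An elementary weighted mean-square continuity lemma -/

omit [DecidableEq Λ] in
/-- Continuous real functions are integrable on the cell. [folklore] -/
theorem integrableOn_angleCell_of_continuous_real {f : (Λ → ℝ) → ℝ} (hf : Continuous f) :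
    IntegrableOn f (angleCell Λ) :=
  (hf.continuousOn.integrableOn_compact (isCompact_univ_pi fun _ : Λ => isCompact_Icc)).mono_set
    angleCell_subset_Icc

omit [DecidableEq Λ] in
/-- **Weighted mean-square continuity**: if `∫ |a_M - b|² → 0` on the cell, then
`∫ w |a_M|² → ∫ w |b|²` for every bounded continuous weight `0 ≤ w ≤ W` (all functions continuous).
(Pointwise `||a|² - |b|²| ≤ (2η)⁻¹|a-b|² + η(|a|² + |b|²)` for every `η > 0`.) [folklore] -/
theorem tendsto_integral_weight_norm_sq {a : ℕ → (Λ → ℝ) → ℂ} {b : (Λ → ℝ) → ℂ} {w : (Λ → ℝ) → ℝ} {W : ℝ}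
    (ha : ∀ M, Continuous (a M)) (hb : Continuous b) (hw : Continuous w) (hw0 : ∀ φ, 0 ≤ w φ)
    (hwW : ∀ φ, w φ ≤ W)
    (hT : Tendsto (fun M => ∫ φ in angleCell Λ, ‖a M φ - b φ‖ ^ 2) atTop (𝓝 0)) :
    Tendsto (fun M => ∫ φ in angleCell Λ, w φ * ‖a M φ‖ ^ 2) atTop (𝓝 (∫ φ in angleCell Λ, w φ * ‖b φ‖ ^ 2)) := by
  set B : ℝ := ∫ φ in angleCell Λ, ‖b φ‖ ^ 2 with hB
  have hB0 : 0 ≤ B := integral_nonneg fun φ => by positivity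
  have hW0 : 0 ≤ W := by
    inhabit (Λ → ℝ)
    exact (hw0 default).trans (hwW default)
  -- the basic estimate, for every `η > 0` and every `M`
  have est : ∀ (η : ℝ), 0 < η → ∀ M,
      |(∫ φ in angleCell Λ, w φ * ‖a M φ‖ ^ 2) - ∫ φ in angleCell Λ, w φ * ‖b φ‖ ^ 2| ≤
        W * ((2 * η)⁻¹ * (∫ φ in angleCell Λ, ‖a M φ - b φ‖ ^ 2) +
          η * (2 * (∫ φ in angleCell Λ, ‖a M φ - b φ‖ ^ 2) + 3 * B)) := by
    intro η hη M
    have hia : IntegrableOn (fun φ => w φ * ‖a M φ‖ ^ 2) (angleCell Λ) :=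
      integrableOn_angleCell_of_continuous_real (hw.mul ((ha M).norm.pow 2))
    have hib : IntegrableOn (fun φ => w φ * ‖b φ‖ ^ 2) (angleCell Λ) :=
      integrableOn_angleCell_of_continuous_real (hw.mul (hb.norm.pow 2))
    have hid : IntegrableOn (fun φ => ‖a M φ - b φ‖ ^ 2) (angleCell Λ) :=
      integrableOn_angleCell_of_continuous_real (((ha M).sub hb).norm.pow 2)
    have hiB : IntegrableOn (fun φ => ‖b φ‖ ^ 2) (angleCell Λ) :=
      integrableOn_angleCell_of_continuous_real (hb.norm.pow 2)
    -- pointwise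
    have hpt : ∀ φ, |w φ * ‖a M φ‖ ^ 2 - w φ * ‖b φ‖ ^ 2| ≤
        W * ((2 * η)⁻¹ * ‖a M φ - b φ‖ ^ 2 + η * (2 * ‖a M φ - b φ‖ ^ 2 + 3 * ‖b φ‖ ^ 2)) := by
      intro φ
      have h1 : |‖a M φ‖ - ‖b φ‖| ≤ ‖a M φ - b φ‖ := abs_norm_sub_norm_le _ _
      have h2 : |‖a M φ‖ ^ 2 - ‖b φ‖ ^ 2| ≤ ‖a M φ - b φ‖ * (‖a M φ‖ + ‖b φ‖) := by
        rw [sq_sub_sq, abs_mul, abs_of_nonneg (by positivity : 0 ≤ ‖a M φ‖ + ‖b φ‖), mul_comm]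
        exact mul_le_mul_of_nonneg_right h1 (by positivity)
      have h3 : ‖a M φ - b φ‖ * (‖a M φ‖ + ‖b φ‖) ≤
          (2 * η)⁻¹ * ‖a M φ - b φ‖ ^ 2 + η * (2 * ‖a M φ - b φ‖ ^ 2 + 3 * ‖b φ‖ ^ 2) := by
        have hna : ‖a M φ‖ ≤ ‖a M φ - b φ‖ + ‖b φ‖ := norm_le_norm_sub_add _ _
        have key : ∀ s t : ℝ, 0 ≤ s → 0 ≤ t → s * t ≤ (2 * η)⁻¹ * s ^ 2 + η / 2 * t ^ 2 := by
          intro s t hs ht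
          have h := sq_nonneg (s - η * t)
          have hη2 : (2 * η)⁻¹ * s ^ 2 + η / 2 * t ^ 2 - s * t = (s - η * t) ^ 2 / (2 * η) := by
            field_simp
            ring
          have : 0 ≤ (s - η * t) ^ 2 / (2 * η) := by positivity
          linarith
        have h4 := key (‖a M φ - b φ‖) (‖a M φ‖ + ‖b φ‖) (norm_nonneg _) (by positivity)
        have h5a : ‖a M φ‖ + ‖b φ‖ ≤ ‖a M φ - b φ‖ + 2 * ‖b φ‖ := by linarith
        have h5b := mul_self_le_mul_self (by positivity) h5a
        have h5 : (‖a M φ‖ + ‖b φ‖) ^ 2 ≤ 3 * ‖a M φ - b φ‖ ^ 2 + 6 * ‖b φ‖ ^ 2 := by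
          nlinarith [h5b, sq_nonneg (‖a M φ - b φ‖ - ‖b φ‖)]
        have h6 := mul_le_mul_of_nonneg_left h5 (by positivity : 0 ≤ η / 2)
        nlinarith [h4, h6, sq_nonneg ‖a M φ - b φ‖, hη.le]
      rw [← mul_sub, abs_mul, abs_of_nonneg (hw0 φ)]
      calc w φ * |‖a M φ‖ ^ 2 - ‖b φ‖ ^ 2| ≤ W * |‖a M φ‖ ^ 2 - ‖b φ‖ ^ 2| :=
            mul_le_mul_of_nonneg_right (hwW φ) (abs_nonneg _)
        _ ≤ W * ((2 * η)⁻¹ * ‖a M φ - b φ‖ ^ 2 + η * (2 * ‖a M φ - b φ‖ ^ 2 + 3 * ‖b φ‖ ^ 2)) :=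
            mul_le_mul_of_nonneg_left (h2.trans h3) hW0
    rw [← integral_sub hia hib]
    refine (abs_integral_le_integral_abs).trans ?_
    have hrhs : IntegrableOn (fun φ => W * ((2 * η)⁻¹ * ‖a M φ - b φ‖ ^ 2 +
        η * (2 * ‖a M φ - b φ‖ ^ 2 + 3 * ‖b φ‖ ^ 2))) (angleCell Λ) :=
      ((hid.const_mul _).add (((hid.const_mul _).add (hiB.const_mul _)).const_mul _)).const_mul _
    calc ∫ φ in angleCell Λ, |w φ * ‖a M φ‖ ^ 2 - w φ * ‖b φ‖ ^ 2|
        ≤ ∫ φ in angleCell Λ, W * ((2 * η)⁻¹ * ‖a M φ - b φ‖ ^ 2 +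
            η * (2 * ‖a M φ - b φ‖ ^ 2 + 3 * ‖b φ‖ ^ 2)) :=
          integral_mono ((hia.sub hib).abs) hrhs hpt
      _ = W * ((2 * η)⁻¹ * (∫ φ in angleCell Λ, ‖a M φ - b φ‖ ^ 2) +
            η * (2 * (∫ φ in angleCell Λ, ‖a M φ - b φ‖ ^ 2) + 3 * B)) := by
          rw [integral_const_mul, integral_add ?_ ?_, integral_const_mul, integral_const_mul, integral_add ?_ ?_,
            integral_const_mul, integral_const_mul]
          · exact hid.const_mul _
          · exact hiB.const_mul _
          · exact hid.const_mul _
          · exact ((hid.const_mul _).add (hiB.const_mul _)).const_mul _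
  -- the `ε`-argument
  rw [Metric.tendsto_atTop]
  intro ε hε
  set η : ℝ := ε / (4 * (W + 1) * (3 * B + 3)) with hη
  have hη0 : 0 < η := by positivity
  have hT' := Metric.tendsto_atTop.1 hT (min 1 (ε * η / (W + 1))) (lt_min one_pos (by positivity))
  obtain ⟨N, hN⟩ := hT'
  refine ⟨N, fun M hM => ?_⟩
  have hTM := hN M hM
  rw [Real.dist_eq, sub_zero, abs_of_nonneg (integral_nonneg fun φ => by positivity)] at hTM
  set T : ℝ := ∫ φ in angleCell Λ, ‖a M φ - b φ‖ ^ 2 with hTdef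
  have hT0 : 0 ≤ T := integral_nonneg fun φ => by positivity
  have hT1 : T < 1 := hTM.trans_le (min_le_left _ _)
  have hT2 : T < ε * η / (W + 1) := hTM.trans_le (min_le_right _ _)
  rw [Real.dist_eq]
  refine (est η hη0 M).trans_lt ?_
  have hW1 : 0 < W + 1 := by linarith
  have h1 : W * ((2 * η)⁻¹ * T) < ε / 2 := by
    have : (2 * η)⁻¹ * T < (2 * η)⁻¹ * (ε * η / (W + 1)) := mul_lt_mul_of_pos_left hT2 (by positivity)
    have e : (2 * η)⁻¹ * (ε * η / (W + 1)) = ε / (2 * (W + 1)) := by field_simp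
    rw [e] at this
    calc W * ((2 * η)⁻¹ * T) ≤ (W + 1) * ((2 * η)⁻¹ * T) := mul_le_mul_of_nonneg_right (by linarith) (by positivity)
      _ < (W + 1) * (ε / (2 * (W + 1))) := mul_lt_mul_of_pos_left this hW1
      _ = ε / 2 := by field_simp
  have h2 : W * (η * (2 * T + 3 * B)) ≤ ε / 4 * ((2 * T + 3 * B) / (3 * B + 3)) := by
    have : W * (η * (2 * T + 3 * B)) ≤ (W + 1) * (η * (2 * T + 3 * B)) :=
      mul_le_mul_of_nonneg_right (by linarith) (by positivity)
    refine this.trans (le_of_eq ?_)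
    rw [hη]
    field_simp
  have h3 : (2 * T + 3 * B) / (3 * B + 3) ≤ 1 := by
    rw [div_le_one (by positivity)]
    linarith
  have h4 : ε / 4 * ((2 * T + 3 * B) / (3 * B + 3)) ≤ ε / 4 := by
    have := mul_le_mul_of_nonneg_left h3 (by positivity : 0 ≤ ε / 4)
    rwa [mul_one] at this
  rw [mul_add]
  linarith

/-! ### The energy as a real number -/

/-- The energy form as a real number:
`(h/2) Σ_x ∫ |∂_x ψ|² + (J/2) Σ_x Σ_{y ∼ x} ∫ (1 - cos(φ_x - φ_y)) |ψ|²`. [cite: KleinPerez1992, §2 (2.1)] -/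
def realEnergy (h J : ℝ) (nn : Λ → Λ → Prop) [DecidableRel nn] (ψ : (Λ → ℝ) → ℂ) : ℝ :=
  h / 2 * ∑ x, (∫ φ in angleCell Λ, ‖fderiv ℝ ψ φ (Pi.single x 1)‖ ^ 2) +
    J / 2 * ∑ x, ∑ y ∈ univ.filter (nn x), (∫ φ in angleCell Λ, (1 - Real.cos (φ x - φ y)) * ‖ψ φ‖ ^ 2)

/-- **`energy = ofReal (realEnergy)`** for every trial state (`h, J ≥ 0`). [folklore] -/
theorem energy_eq_ofReal_realEnergy {h J : ℝ} (hh : 0 ≤ h) (hJ : 0 ≤ J) (nn : Λ → Λ → Prop) [DecidableRel nn]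
    (Ψ : TrialState Λ) : energy h J nn Ψ = ENNReal.ofReal (realEnergy h J nn Ψ.ψ) := by
  set F : (Λ → ℝ) → ℝ := fun φ => h / 2 * ∑ x, ‖fderiv ℝ Ψ.ψ φ (Pi.single x 1)‖ ^ 2 +
    (J / 2 * ∑ x, ∑ y ∈ univ.filter (nn x), (1 - Real.cos (φ x - φ y))) * ‖Ψ.ψ φ‖ ^ 2 with hF
  have hψc : Continuous Ψ.ψ := Ψ.contDiff.continuous
  have hdc : ∀ x, Continuous fun φ => fderiv ℝ Ψ.ψ φ (Pi.single x 1) := fun x =>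
    (Ψ.contDiff.continuous_fderiv one_ne_zero).clm_apply continuous_const
  have hVc : Continuous fun φ : Λ → ℝ => J / 2 * ∑ x, ∑ y ∈ univ.filter (nn x), (1 - Real.cos (φ x - φ y)) :=
    continuous_const.mul (continuous_finsetSum _ fun x _ => continuous_finsetSum _ fun y _ =>
      continuous_const.sub (Real.continuous_cos.comp ((continuous_apply x).sub (continuous_apply y))))
  have hkin_c : ∀ x, Continuous fun φ => ‖fderiv ℝ Ψ.ψ φ (Pi.single x 1)‖ ^ 2 := fun x => ((hdc x).norm).pow 2
  have hFc : Continuous F := (continuous_const.mul (continuous_finsetSum _ fun x _ => hkin_c x)).add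
    (hVc.mul ((hψc.norm).pow 2))
  have hF0 : ∀ φ, 0 ≤ F φ := by
    intro φ
    have hV : 0 ≤ J / 2 * ∑ x, ∑ y ∈ univ.filter (nn x), (1 - Real.cos (φ x - φ y)) := by
      refine mul_nonneg (by positivity) (sum_nonneg fun x _ => sum_nonneg fun y _ => ?_)
      linarith [Real.cos_le_one (φ x - φ y)]
    positivity
  have hFi : IntegrableOn F (angleCell Λ) := integrableOn_angleCell_of_continuous_real hFc
  rw [energy_eq_lintegral_ofReal hh hJ, ← ofReal_integral_eq_lintegral_ofReal hFi (ae_of_all _ hF0)]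
  congr 1
  have hkin_i : ∀ x, IntegrableOn (fun φ => ‖fderiv ℝ Ψ.ψ φ (Pi.single x 1)‖ ^ 2) (angleCell Λ) :=
    fun x => integrableOn_angleCell_of_continuous_real (hkin_c x)
  have hpot_i : ∀ x y, IntegrableOn (fun φ : Λ → ℝ => (1 - Real.cos (φ x - φ y)) * ‖Ψ.ψ φ‖ ^ 2) (angleCell Λ) :=
    fun x y => integrableOn_angleCell_of_continuous_real
      ((continuous_const.sub (Real.continuous_cos.comp ((continuous_apply x).sub (continuous_apply y)))).mul
        ((hψc.norm).pow 2))
  have e1 : ∀ φ, F φ = h / 2 * ∑ x, ‖fderiv ℝ Ψ.ψ φ (Pi.single x 1)‖ ^ 2 +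
      J / 2 * ∑ x, ∑ y ∈ univ.filter (nn x), (1 - Real.cos (φ x - φ y)) * ‖Ψ.ψ φ‖ ^ 2 := by
    intro φ
    simp only [hF, mul_assoc, sum_mul]
  simp_rw [e1]
  rw [realEnergy, integral_add, integral_const_mul, integral_const_mul, integral_finsetSum _ (fun x _ => hkin_i x),
    integral_finsetSum _ (fun x _ => integrable_finsetSum _ fun y _ => hpot_i x y)]
  · congr 1
    congr 1
    exact sum_congr rfl fun x _ => integral_finsetSum _ fun y _ => hpot_i x y
  · exact (integrable_finsetSum _ fun x _ => hkin_i x).const_mul _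
  · exact (integrable_finsetSum _ fun x _ => integrable_finsetSum _ fun y _ => hpot_i x y).const_mul _

/-- `realEnergy ≥ 0` for `h, J ≥ 0`. [folklore] -/
theorem realEnergy_nonneg {h J : ℝ} (hh : 0 ≤ h) (hJ : 0 ≤ J) (nn : Λ → Λ → Prop) [DecidableRel nn]
    (ψ : (Λ → ℝ) → ℂ) : 0 ≤ realEnergy h J nn ψ := by
  unfold realEnergy
  refine add_nonneg (mul_nonneg (by positivity) (sum_nonneg fun x _ => integral_nonneg fun φ => by positivity))
    (mul_nonneg (by positivity) (sum_nonneg fun x _ => sum_nonneg fun y _ => integral_nonneg fun φ => ?_))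
  have := Real.cos_le_one (φ x - φ y)
  exact mul_nonneg (by linarith) (by positivity)

/-- Scaling: `realEnergy (λ ψ) = λ² realEnergy ψ` for real `λ > 0` and differentiable `ψ`. [folklore] -/
theorem realEnergy_const_mul (h J : ℝ) (nn : Λ → Λ → Prop) [DecidableRel nn] {ψ : (Λ → ℝ) → ℂ}
    (hψ : Differentiable ℝ ψ) (lam : ℝ) :
    realEnergy h J nn (fun φ => (lam : ℂ) * ψ φ) = lam ^ 2 * realEnergy h J nn ψ := by
  have e1 : ∀ x, (∫ φ in angleCell Λ, ‖fderiv ℝ (fun φ => (lam : ℂ) * ψ φ) φ (Pi.single x 1)‖ ^ 2) =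
      lam ^ 2 * ∫ φ in angleCell Λ, ‖fderiv ℝ ψ φ (Pi.single x 1)‖ ^ 2 := by
    intro x
    rw [← integral_const_mul]
    refine integral_congr_ae (ae_of_all _ fun φ => ?_)
    simp only
    rw [fderiv_const_mul (hψ φ), FunLike.coe_smul, Pi.smul_apply, smul_eq_mul, norm_mul, mul_pow,
      Complex.norm_real, Real.norm_eq_abs, sq_abs]
  have e2 : ∀ x y, (∫ φ in angleCell Λ, (1 - Real.cos (φ x - φ y)) * ‖(lam : ℂ) * ψ φ‖ ^ 2) =
      lam ^ 2 * ∫ φ in angleCell Λ, (1 - Real.cos (φ x - φ y)) * ‖ψ φ‖ ^ 2 := by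
    intro x y
    rw [← integral_const_mul]
    refine integral_congr_ae (ae_of_all _ fun φ => ?_)
    simp only
    rw [norm_mul, mul_pow, Complex.norm_real, Real.norm_eq_abs, sq_abs]
    ring
  simp only [realEnergy, e1, e2, ← mul_sum]
  ring

/-! ### Density of trigonometric polynomials in the energy form -/

/-- `trigPoly` is linear in the coefficients (scalar multiples). [folklore] -/
theorem trigPoly_smul (M : ℕ) (r : ℂ) (c : TensorIndex Λ (2 * M + 1) → ℂ) :
    trigPoly M (r • c) = fun φ => r * trigPoly M c φ := by
  funext φ
  simp only [trigPoly, Pi.smul_apply, smul_eq_mul, mul_sum, mul_assoc]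

/-- `⟨c, c⟩ = Σ |c_σ|²` as a complex number. [folklore] -/
theorem star_dotProduct_self_eq {ι : Type*} [Fintype ι] (c : ι → ℂ) :
    star c ⬝ᵥ c = ((∑ i, ‖c i‖ ^ 2 : ℝ) : ℂ) := by
  simp only [dotProduct, Pi.star_apply, Complex.star_def, Complex.ofReal_sum]
  refine sum_congr rfl fun i _ => ?_
  rw [mul_comm, Complex.mul_conj, Complex.normSq_eq_norm_sq]

/-- **Density**: for every trial state `Ψ` and every `δ > 0` there are a degree `M` and a unit
coefficient vector `c` whose normalised trigonometric polynomial has energy at most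
`energy Ψ + δ` (`h, J ≥ 0`, irreflexive neighbour relation, `Λ` nonempty). The `c` is the
normalised box partial sum of the Fourier series of `Ψ`. [cite: KleinPerez1992, §3] -/
theorem exists_trialOf_energy_le [Nonempty Λ] {h J : ℝ} (hh : 0 ≤ h) (hJ : 0 ≤ J)
    (nn : Λ → Λ → Prop) [DecidableRel nn] (Ψ : TrialState Λ) {δ : ℝ} (hδ : 0 < δ) :
    ∃ (M : ℕ) (c : TensorIndex Λ (2 * M + 1) → ℂ) (hc : star c ⬝ᵥ c = 1),
      energy h J nn (trialOf M c hc) ≤ energy h J nn Ψ + ENNReal.ofReal δ := by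
  set κ : ℝ := (2 * Real.pi) ^ Fintype.card Λ with hκ
  have hκpos : 0 < κ := by positivity
  have hψc : Continuous Ψ.ψ := Ψ.contDiff.continuous
  have hψd : Differentiable ℝ Ψ.ψ := Ψ.contDiff.differentiable one_ne_zero
  -- the box partial sums and their mean-square convergence
  set cM : (M : ℕ) → TensorIndex Λ (2 * M + 1) → ℂ := fun M => partialSumCoeff M Ψ.ψ with hcM
  set S : ℕ → (Λ → ℝ) → ℂ := fun M => fourierPartialSum M Ψ.ψ with hS
  have hSc : ∀ M, Continuous (S M) := fun M => continuous_trigPoly M _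
  have hT : Tendsto (fun M => ∫ φ in angleCell Λ, ‖S M φ - Ψ.ψ φ‖ ^ 2) atTop (𝓝 0) := by
    have h := tendsto_integral_norm_sq_sub_fourierPartialSum hψc Ψ.periodic
    refine h.congr fun M => integral_congr_ae (ae_of_all _ fun φ => ?_)
    simp only [hS, fourierPartialSum, norm_sub_rev]
  -- derivatives
  have hdc : ∀ x, Continuous fun φ => fderiv ℝ Ψ.ψ φ (Pi.single x 1) := fun x =>
    (Ψ.contDiff.continuous_fderiv one_ne_zero).clm_apply continuous_const
  have hdp : ∀ (x : Λ) (φ : Λ → ℝ) (y : Λ), fderiv ℝ Ψ.ψ (φ + Pi.single y (2 * Real.pi)) (Pi.single x 1) =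
      fderiv ℝ Ψ.ψ φ (Pi.single x 1) := fun x φ y => by rw [fderiv_periodic Ψ.periodic]
  have hSd : ∀ M, Differentiable ℝ (S M) := fun M => (contDiff_trigPoly M _ (k := 1)).differentiable one_ne_zero
  have hdSc : ∀ M x, Continuous fun φ => fderiv ℝ (S M) φ (Pi.single x 1) := fun M x =>
    ((contDiff_trigPoly M _ (k := 1)).continuous_fderiv one_ne_zero).clm_apply continuous_const
  have hTd : ∀ x, Tendsto (fun M => ∫ φ in angleCell Λ, ‖fderiv ℝ (S M) φ (Pi.single x 1) -
      fderiv ℝ Ψ.ψ φ (Pi.single x 1)‖ ^ 2) atTop (𝓝 0) := by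
    intro x
    have h := tendsto_integral_norm_sq_sub_fourierPartialSum (hdc x) (hdp x)
    refine h.congr fun M => integral_congr_ae (ae_of_all _ fun φ => ?_)
    have e := fderiv_fourierPartialSum M Ψ φ x
    simp only [fourierPartialSum] at e
    simp only [hS, fourierPartialSum, e, norm_sub_rev]
  -- convergence of the pieces of the energy
  have hkin : ∀ x, Tendsto (fun M => ∫ φ in angleCell Λ, ‖fderiv ℝ (S M) φ (Pi.single x 1)‖ ^ 2) atTop
      (𝓝 (∫ φ in angleCell Λ, ‖fderiv ℝ Ψ.ψ φ (Pi.single x 1)‖ ^ 2)) := by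
    intro x
    have h := tendsto_integral_weight_norm_sq (w := fun _ => (1 : ℝ)) (W := 1) (hdSc · x) (hdc x)
      continuous_const (fun _ => zero_le_one) (fun _ => le_rfl) (hTd x)
    simpa only [one_mul] using h
  have hpot : ∀ x y, Tendsto (fun M => ∫ φ in angleCell Λ, (1 - Real.cos (φ x - φ y)) * ‖S M φ‖ ^ 2) atTop
      (𝓝 (∫ φ in angleCell Λ, (1 - Real.cos (φ x - φ y)) * ‖Ψ.ψ φ‖ ^ 2)) := by
    intro x y
    exact tendsto_integral_weight_norm_sq (w := fun φ : Λ → ℝ => 1 - Real.cos (φ x - φ y)) (W := 2) hSc hψc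
      (continuous_const.sub (Real.continuous_cos.comp ((continuous_apply x).sub (continuous_apply y))))
      (fun φ => by linarith [Real.cos_le_one (φ x - φ y)]) (fun φ => by linarith [Real.neg_one_le_cos (φ x - φ y)]) hT
  have hE : Tendsto (fun M => realEnergy h J nn (S M)) atTop (𝓝 (realEnergy h J nn Ψ.ψ)) := by
    simp only [realEnergy]
    exact ((tendsto_finsetSum _ fun x _ => hkin x).const_mul _).add
      ((tendsto_finsetSum _ fun x _ => tendsto_finsetSum _ fun y _ => hpot x y).const_mul _)
  -- the norms: `κ q_M = ∫ |S_M|² → 1`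
  set q : ℕ → ℝ := fun M => ∑ σ, ‖cM M σ‖ ^ 2 with hq
  have hnormS : ∀ M, ∫ φ in angleCell Λ, ‖S M φ‖ ^ 2 = κ * q M := fun M => by
    simp only [hS, hq, hcM, fourierPartialSum, integral_norm_sq_trigPoly, hκ]
  have hq_lim : Tendsto (fun M => κ * q M) atTop (𝓝 1) := by
    have h := tendsto_integral_weight_norm_sq (w := fun _ => (1 : ℝ)) (W := 1) hSc hψc continuous_const
      (fun _ => zero_le_one) (fun _ => le_rfl) hT
    simp only [one_mul, integral_norm_sq_eq_one, hnormS] at h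
    exact h
  have hq_pos : ∀ᶠ M in atTop, 0 < q M := by
    have h := hq_lim.eventually (lt_mem_nhds (show (1 : ℝ) / 2 < 1 by norm_num))
    exact h.mono fun M hM => by nlinarith
  -- the normalised vectors and the scaling factor `λ_M² = κ⁻¹ / q_M → 1`
  have hlam : Tendsto (fun M => cellNormConst Λ ^ 2 / q M) atTop (𝓝 1) := by
    have hc2 : cellNormConst Λ ^ 2 = κ⁻¹ := by
      have := cellNormConst_sq_mul (Λ := Λ)
      rw [← hκ] at this
      field_simp
      linarith
    have h := hq_lim.inv₀ one_ne_zero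
    rw [inv_one] at h
    refine h.congr' (hq_pos.mono fun M _ => ?_)
    rw [hc2]
    simp only [mul_inv, div_eq_mul_inv]
  have hfinal : Tendsto (fun M => cellNormConst Λ ^ 2 / q M * realEnergy h J nn (S M)) atTop
      (𝓝 (realEnergy h J nn Ψ.ψ)) := by
    have := hlam.mul hE
    rwa [one_mul] at this
  -- extract `M`
  have hev : ∀ᶠ M in atTop, cellNormConst Λ ^ 2 / q M * realEnergy h J nn (S M) < realEnergy h J nn Ψ.ψ + δ :=
    hfinal.eventually (gt_mem_nhds (by linarith))
  obtain ⟨M, hMq, hME⟩ := (hq_pos.and hev).exists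
  -- the unit vector
  set r : ℝ := Real.sqrt (q M) with hr
  have hr0 : 0 < r := Real.sqrt_pos.2 hMq
  set c : TensorIndex Λ (2 * M + 1) → ℂ := ((r : ℂ)⁻¹) • cM M with hc_def
  have hc : star c ⬝ᵥ c = 1 := by
    rw [hc_def, star_smul, smul_dotProduct, dotProduct_smul, star_dotProduct_self_eq, smul_smul, smul_eq_mul]
    have e : (∑ i, ‖cM M i‖ ^ 2 : ℝ) = r * r := by rw [hr, Real.mul_self_sqrt hMq.le]
    rw [e, Complex.star_def, ← Complex.ofReal_inv, Complex.conj_ofReal]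
    push_cast
    field_simp [hr0.ne']
  refine ⟨M, c, hc, ?_⟩
  -- its energy
  have hψM : (trialOf M c hc).ψ = fun φ => ((cellNormConst Λ * r⁻¹ : ℝ) : ℂ) * S M φ := by
    funext φ
    rw [trialOf_ψ, hc_def, trigPoly_smul]
    simp only [hS, fourierPartialSum, hcM]
    push_cast
    ring
  have hreal : realEnergy h J nn (trialOf M c hc).ψ = cellNormConst Λ ^ 2 / q M * realEnergy h J nn (S M) := by
    rw [hψM, realEnergy_const_mul h J nn (hSd M), mul_pow, inv_pow, hr, Real.sq_sqrt hMq.le, div_eq_mul_inv]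
  rw [energy_eq_ofReal_realEnergy hh hJ nn, energy_eq_ofReal_realEnergy hh hJ nn, hreal,
    ← ENNReal.ofReal_add (realEnergy_nonneg hh hJ nn Ψ.ψ) hδ.le]
  exact ENNReal.ofReal_le_ofReal hME.le

end QuantumRotor

end Literature.MathematicalPhysics.QuantumLattice
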